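import Literature.Algebra.EuclideanLattices.DualGridAttemptSuccess
import Literature.Algebra.EuclideanLattices.MRIncGDDSolver
import HarnessLib

/-!
# One run of the procedure `W` of MR07 Thm. 5.23 on the integer fine grid of the dual lattice: abort unless `z` solves `SIS′`, and the non-abort probability — proved

Topic `Algebra/EuclideanLattices` (family `pqc`). Micciancio–Regev 2007, proof of Thm. 5.23, step (2)
(authors' version p. 29): "`W(B, S)`: run the sampling procedure `m` times …, the combining procedure
with `F` …; abort unless `z` is an `SIS′` solution; output `w = x − Yz ∈ L(B)*`". This is the twin of
`MRGapCVPRun.lean` (which does the same on the skewed grid `L(S)/M` of `MRIncGDDIdealised.lean`) for the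
BIT-LEVEL model of the tree in which the machine actually runs — the dual-grid model of
`DualGridCosetModel`/`DualGridAttemptSpec`/`DualGridAttemptSuccess` (lattice `Λ = dualLat B = det(B)²·L(B)*`,
fine grid `(1/N)ℤⁿ`, coin boxes for the `v`-randomness, experiment `experimentD` with ZERO shifts, output
`outputD = x − ∑ zᵢyᵢ`):

* `WLat B` — the lattice in which the witnesses are typed: the bidual `(Λ*)*` (`= Λ`,
  `dualLattice_dualLattice`; typing the witnesses in the dual of `L₀ = Λ*` lets the verifier analysis of
  `MRGapCVPIdealisedZ.lean`, written for witnesses in `dualLattice L`, apply with `L = L₀`);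
* `xVecOf_crepInt_mem`, `outputD_mem` — the output is always a vector of `Λ` (Lemma 5.8 (ii) is built into
  the integer arithmetic: `DualGridAttemptSpec.xVec_mem`);
* `wRunD` — the run (definition with body): `some (x − ∑ zᵢyᵢ)` if `IsSolution' A β z`, `none` otherwise;
* `map_experimentD_az_eq` — the law of the pair `(A, z)` under `experimentD`;
* `toReal_wRunD_none_le` — **`Pr[abort] ≤ 1 − (δ′ − m·(2ε/(1+ε) + n·dT/2^ℓ + n·q/N))`** where
  `δ′ = Pr_{A ∼ U, z ∼ O(A)}[IsSolution' A β z]` (MR07 p. 30: "the success probability of `W` is at least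
  `δ − mε/2`"), by kernel contraction and `DualGridAttemptSuccess.tvDist_queryD_le`.

## References

* D. Micciancio, O. Regev, *Worst-case to average-case reductions based on Gaussian measures*,
  SIAM J. Comput. 37 (2007) 267–302; authors' version, proof of Thm. 5.23, pp. 29–30.
-/

noncomputable section

open scoped Classical ENNReal Real

namespace Literature.Algebra.EuclideanLattices

open Module Submodule Matrix GSInverse Finset Literature.Probability.Distributions PMF MeasureTheory
  Literature.Computability.Cryptography Literature.Computability.Cryptography.SIS

namespace DualGrid

variable {n : ℕ} (B : Matrix (Fin n) (Fin n) ℤ) (N : ℕ) (S : Fin n → Fin n → ℤ)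

/-! ### The lattice of the witnesses -/

/-- The lattice in which the witnesses of `W` are typed: the bidual `(Λ*)*` of `Λ = dualLat B` (equal to
`Λ` for nonsingular `B`, `WLat_eq`). [folklore] -/
abbrev WLat : Submodule ℤ (EuclideanSpace ℝ (Fin n)) := dualLattice (dualLattice (dualLat B))

variable {B} in
/-- `(Λ*)* = Λ`. [folklore] -/
theorem WLat_eq [IsZLattice ℝ (dualLat B)] : WLat B = dualLat B := dualLattice_dualLattice _

variable {B} in
/-- A vector of `Λ` is a vector of `(Λ*)*`. [folklore] -/
theorem mem_WLat_of_mem [IsZLattice ℝ (dualLat B)] {x : EuclideanSpace ℝ (Fin n)} (hx : x ∈ dualLat B) : x ∈ WLat B := by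
  rw [WLat_eq]; exact hx

/-! ### The output is a lattice vector -/

variable {B N S} {m : ℕ}

/-- **`x ∈ Λ`** for the combining output written from offset representatives (the integer arithmetic of
the attempt produces an integer combination of lattice vectors, `DualGridAttemptSpec.xVec_mem`).
[cite: MicciancioRegev2007, Lemma 5.8 (ii)] -/
theorem xVecOf_crepInt_mem [NeZero N] (hS : ∀ j, intVecToEuclidean n (S j) ∈ dualLat B) (q : ℕ) (c : Fin m → Grp B N)
    (κ : Fin m → Fin n → ℤ) (z : Fin m → ℤ) :
    intVecToEuclidean n (xVecOf B N S q (fun i => crepInt B N (c i)) κ z) ∈ dualLat B := by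
  have h := xVec_mem (N := N) hS q (fun i => -liftVec B N (c i)) κ z
  rw [xVec_eq_xVecOf] at h
  simpa only [crep_neg_liftVec] using h

/-- **The output `x − ∑ zᵢyᵢ` of a run is a vector of `Λ`.** [cite: MicciancioRegev2007, Thm. 5.23 (proof, p. 29: "w = x − Yz ∈ L(B)*")] -/
theorem outputD_mem [NeZero N] (hS : ∀ j, intVecToEuclidean n (S j) ∈ dualLat B) (q : ℕ)
    (ω : (((Fin m → Grp B N) × (Fin m → Fin n → ℤ)) × (Matrix (Fin n) (Fin m) (ZMod q) × (Fin m → ℤ))) × (Fin m → dualLat B)) :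
    outputD B N S q ω ∈ dualLat B := by
  refine (dualLat B).sub_mem (xVecOf_crepInt_mem hS q _ _ _) (Submodule.sum_mem _ fun i _ => ?_)
  rw [Int.cast_smul_eq_zsmul]
  exact (dualLat B).smul_mem _ (ω.2 i).2

variable (B N S)
variable [NeZero N]

/-! ### The run -/

/-- **One run of `W(B, S)`** (MR07 Thm. 5.23, step (2)) in the dual-grid model: the idealised experiment
with zero shifts; keep `w = x − ∑ zᵢyᵢ` iff `z` is an `SIS′` solution of the query (and `w ∈ (Λ*)*` —
automatic, recorded to type the output). [cite: MicciancioRegev2007, Thm. 5.23 (proof, step (2), p. 29)] -/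
def wRunD (hB : B.det ≠ 0) {q : ℕ} (O : Matrix (Fin n) (Fin m) (ZMod q) → PMF (Fin m → ℤ)) (s β : ℝ) (ℓ : ℕ) :
    PMF (Option (WLat B)) :=
  (experimentD B N S hB O s (fun _ => 0) ℓ).map fun ω =>
    if h : IsSolution' ω.1.2.1 β ω.1.2.2 ∧ outputD B N S q ω ∈ WLat B then some ⟨_, h.2⟩ else none

/-- **The law of `(A, z)` under the experiment** is the query law followed by the oracle pairing. [folklore] -/
theorem map_experimentD_az_eq (hB : B.det ≠ 0) {q : ℕ} (O : Matrix (Fin n) (Fin m) (ZMod q) → PMF (Fin m → ℤ)) (s : ℝ)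
    (Tsh : Fin m → Fin n → ℤ) (ℓ : ℕ) :
    (experimentD B N S hB O s Tsh ℓ).map (fun ω => ω.1.2) =
      ((((indepLaw m fun i => offsetLawD B N hB s (Tsh i)).bind fun c =>
          (indepLaw m fun _ => boxLaw n ℓ).map (Prod.mk c)).bind fun ch =>
          PMF.pure (queryMatrixD B N S q ch.1 ch.2)).bind fun A => (O A).map (Prod.mk A)) := by
  rw [experimentD, PMF.map_bind]
  conv_rhs => rw [PMF.bind_bind]
  refine congrArg (PMF.bind _) (funext fun ch => ?_)
  rw [PMF.map_bind]
  have h : ∀ y : Fin m → dualLat B,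
      (((PMF.pure (queryMatrixD B N S q ch.1 ch.2)).bind fun A => (O A).map (Prod.mk A)).map
          fun az => ((ch, az), y)).map (fun ω => ω.1.2) =
        (PMF.pure (queryMatrixD B N S q ch.1 ch.2)).bind fun A => (O A).map (Prod.mk A) := by
    intro y
    rw [PMF.map_comp]
    exact PMF.map_id _
  simp_rw [h]
  exact PMF.bind_const _ _

/-- **The abort probability of one run of `W` in the dual-grid model** (MR07 p. 30): for `0 < ε`,
`0 < s`, `η_ε(Λ) ≤ s`, `1 ≤ q ≤ N`,
`Pr[wRunD = none] ≤ 1 − (δ′ − m·(2ε/(1+ε) + n·dT/2^ℓ + n·q/N))`, `δ′ = Pr_{A ∼ U, z ∼ O(A)}[IsSolution' A β z]`.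
[cite: MicciancioRegev2007, Thm. 5.23 (proof, p. 30)] -/
theorem toReal_wRunD_none_le [IsZLattice ℝ (dualLat B)] (hB : B.det ≠ 0)
    (hS : ∀ j, intVecToEuclidean n (S j) ∈ dualLat B) (hli : LinearIndependent ℝ fun j => intVecToEuclidean n (S j))
    [NeZero (MM B N S)] [NeZero (Mo B N)] {q : ℕ} [NeZero q] (hqN : q ≤ N)
    (O : Matrix (Fin n) (Fin m) (ZMod q) → PMF (Fin m → ℤ)) {ε s : ℝ} (hε : 0 < ε) (hs : 0 < s)
    (hηs : smoothingParameter (dualLat B) ε ≤ s) (β : ℝ) (ℓ : ℕ) :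
    ((wRunD B N S hB O s β ℓ) none).toReal ≤
      1 - ((((PMF.uniformOfFintype (Matrix (Fin n) (Fin m) (ZMod q))).bind fun A =>
              (O A).map (Prod.mk A)).toOuterMeasure {az | IsSolution' az.1 β az.2}).toReal -
            m * (2 * ε / (1 + ε) + n * (((dT B S).toNat : ℝ) / 2 ^ ℓ) + n * ((q : ℝ) / N))) := by
  rw [wRunD, MicciancioRegev2007.toReal_map_dite_none]
  set E := experimentD B N S hB O s (fun _ => (0 : Fin n → ℤ)) ℓ with hE
  have hsub : {ω | IsSolution' ω.1.2.1 β ω.1.2.2} ⊆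
      {ω : (((Fin m → Grp B N) × (Fin m → Fin n → ℤ)) × (Matrix (Fin n) (Fin m) (ZMod q) × (Fin m → ℤ))) ×
        (Fin m → dualLat B) | IsSolution' ω.1.2.1 β ω.1.2.2 ∧ outputD B N S q ω ∈ WLat B} :=
    fun ω hω => ⟨hω, mem_WLat_of_mem (outputD_mem hS q ω)⟩
  have h1 : (E.toOuterMeasure {ω | IsSolution' ω.1.2.1 β ω.1.2.2}).toReal ≤
      (E.toOuterMeasure {ω | IsSolution' ω.1.2.1 β ω.1.2.2 ∧ outputD B N S q ω ∈ WLat B}).toReal :=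
    ENNReal.toReal_mono (PMF.toOuterMeasure_ne_top _ _) (E.toOuterMeasure_mono (Set.inter_subset_left.trans hsub))
  have hmarg : (E.toOuterMeasure {ω | IsSolution' ω.1.2.1 β ω.1.2.2}).toReal =
      ((E.map fun ω => ω.1.2).toOuterMeasure {az | IsSolution' az.1 β az.2}).toReal := by
    rw [PMF.toOuterMeasure_map_apply]; rfl
  rw [hE, map_experimentD_az_eq] at hmarg
  rw [← hE] at hmarg
  set μA := (((indepLaw m fun i => offsetLawD B N hB s ((fun _ => (0 : Fin n → ℤ)) i)).bind fun c =>
      (indepLaw m fun _ => boxLaw n ℓ).map (Prod.mk c)).bind fun ch => PMF.pure (queryMatrixD B N S q ch.1 ch.2)) with hμA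
  have h3 := (abs_le.1 (PMF.abs_toReal_toOuterMeasure_bind_sub_le_tvDist μA
    (PMF.uniformOfFintype (Matrix (Fin n) (Fin m) (ZMod q))) (fun A => (O A).map (Prod.mk A))
    {az | IsSolution' az.1 β az.2})).1
  have h4 := tvDist_queryD_le hB hS hli hqN hε hs hηs (fun _ : Fin m => (0 : Fin n → ℤ)) ℓ
  rw [← hμA] at h4
  linarith

end DualGrid

end Literature.Algebra.EuclideanLattices

end
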